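import Summits.ABC.IUTFork.Thm311RealInd1StripGenuineK
import Mathlib.LinearAlgebra.PiTensorProduct.Dual
import HarnessLib

/-!
# [IUTchIII] Thm 3.11 (i) (Ind1) AT THE LEVEL OF THE TYPED SIGNATURE: print's (Ind1)-set `LogShells.Ind1 j` of the real instantiation
# is INFINITE at every label `j` as soon as ONE strip slot is infinite — hence at every genuine initial Θ-datum (modulo
# `JannsenWingbergTwists`) — while Dupuy–Hilado's is FINITE (permutations of the capsule only)

PROOF-ONLY file (abc-iut cell, Cor. 3.12 sub-crew, seat abc-iut-c312-1 = holder of record of the typed [IUTchIII] Thm. 3.11,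
gen 13; row «R16 (Ind1)-STRIP AT GENUINE BAD PLACES», part b — the signature-level reading).  TAKES NO SIDE on [IUTchIII] Cor. 3.12.

The typed Theorem 3.11 (`Thm311Sig`, p403784) records (Ind1) at label `j` as the SET `LogShells.Ind1 j` of families
`v_ℚ ↦ (Packet j v_ℚ ⥲ Packet j v_ℚ)` induced by ONE permutation `σ` of the capsule `S^±_{j+1}` and, independently for every factor
`i` and place `v`, a strip automorphism `h i v ∈ L.stripAut v` ([IUTchIII] Thm. 3.11 (i) p. 154 «the indeterminacies induced by the
automorphisms of the procession of `𝒟^⊢`-prime-strips `Prc(^{n,∘}𝔇^⊢_T)`»; [IUTchI] Def. 4.1 (iv), Def. 4.10).  The two real instantiations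
of record differ in the strip slot only: Dupuy–Hilado's `Real.logShellsDH` has `stripAut = Real.stripAutDH = {1}` (§4.7 «We will call Ind1
the collection of all such permutations»), print's `Real.logShellsPrint` (gen 8 p450750) has `Real.ind1Strip logv v` at the finite places.
* `LogShells.ind1_finite_of_stripAut_eq_singleton` — generic: if every strip slot is `{1}`, `Ind1 j` is the FINITE set of capsule
  permutations (`#S_{j+1}` elements at most);
* **`LogShells.ind1_infinite_of_stripAut_infinite`** — generic: if ONE strip slot `L.stripAut v₀` is infinite, `Ind1 j` is INFINITE for
  EVERY label `j`: `ψ ↦ (id ⊗ ⋯ ⊗ (ψ at the summand v₀ of factor 0) ⊗ ⋯)` is injective on strip automorphisms — tested on the pure tensor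
  `m ⊗ ⋯ ⊗ m`, `m = (x at v₀, 0 elsewhere)`, against the functionals `⊗_i (λ_i ∘ pr_{v₀})` (`PiTensorProduct.dualDistrib`);
* `LogShells.ind1Family_infinite_of_stripAut_infinite` — the same for the set `LogShells.Ind1Family` of label-indexed families
  (`Thm311Multirad`, p404064) by which (Ind1) acts on the data (a)(b)(c);
* `Real.ind1_logShellsDH_finite` / **`Real.ind1_logShellsPrint_infinite_of_mem_S_pilotDataOfK`** — at the REAL instantiation over the
  `K`-level pilot datum of a genuine initial Θ-datum ([IUTchI] Def. 3.1): Dupuy–Hilado's `Ind1 j` is finite at every label, print's is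
  INFINITE at every label modulo `JannsenWingbergTwists` (part a: the strip slot at any bad place is infinite), and so is print's
  `Ind1Family`.
Reading for the record (neutral, OUR typed objects): at every genuine initial Θ-datum the two readings of (Ind1) in the cell's books — DH's
(finite: capsule permutations) and print's (infinite, modulo the Jannsen–Wingberg structure theorem) — are different SETS in the typed
signature of [IUTchIII] Thm. 3.11 (i) itself, not only place by place; which elements move which regions is the content of the gen-8–13
single-place files.  HONEST SCOPE: conditional on `hJW` where stated; nothing here asserts or refutes [IUTchIII] Cor. 3.12; NO abc claim.
[claim: Mochizuki2012, status: disputed] ([IUTchIII] Thm. 3.11 (i) p. 154; [IUTchI] Def. 3.1, Def. 4.1 (iv), Def. 4.10);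
[cite: DupuyHilado2025, §4.7]; [cite: JannsenWingberg1982, §5.1 p.96]; [cite: HoshiNishio2022OuterAutMLF, Thm 1.5, Cor 1.6 (i)].
typed ≠ proved; a conditional theorem discharges nothing it binds.
-/

set_option autoImplicit false

noncomputable section

open Set
open scoped TensorProduct

namespace Summit.ABC.IUTFork.Thm311

/-! ## 1. Generic: the size of `Ind1 j` is governed by the strip slots -/

namespace LogShells

variable {T : ThetaIndex} (L : LogShells T)

/-- **If every strip slot is the singleton `{1}`, `Ind1 j` is FINITE** — it is contained in the image of the finite group of permutations of
the capsule `S^±_{j+1}` (the summand-wise / factor-wise part is the identity). [folklore] -/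
theorem ind1_finite_of_stripAut_eq_singleton (hstrip : ∀ v, L.stripAut v = {LinearEquiv.refl ℚ (L.carrier v)}) (j : T.Label) :
    (L.Ind1 j).Finite := by
  refine (Set.finite_range fun σ : Equiv.Perm (T.Caps j) => fun vQ => L.permute j vQ σ).subset ?_
  rintro Φ ⟨σ, h, hh, hΦ⟩
  refine ⟨σ, funext fun vQ => ?_⟩
  have hrefl : h = fun _ v => LinearEquiv.refl ℚ (L.carrier v) := by
    funext i v
    have := hh i v
    rw [hstrip v] at this
    exact this
  rw [hΦ vQ, hrefl]
  show L.permute j vQ σ =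
    (L.permute j vQ σ).trans (L.factorwise j vQ fun _ => L.summandwise vQ fun v => LinearEquiv.refl ℚ (L.carrier v.1))
  rw [summandwise_refl_family, factorwise_refl, LinearEquiv.trans_refl]

/-- **If ONE strip slot `L.stripAut v₀` is infinite, `Ind1 j` is INFINITE at every label `j`.**  The map sending a strip automorphism `ψ` at
`v₀` to the family «identity permutation; `ψ` on the summand `v₀` of the factor `0`, identity elsewhere» lands in `Ind1 j` and is injective:
evaluate at `v_ℚ(v₀)` on the pure tensor `m ⊗ ⋯ ⊗ m` with `m` supported at `v₀` with value `x`, and test with the functionals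
`⊗_i (λ_i ∘ pr_{v₀})`, `λ_0 = μ` arbitrary, `λ_i(x) = 1` otherwise (`PiTensorProduct.dualDistrib`): the value is `μ(ψ x)`, so `ψ x` is
determined for every `x`. [folklore] -/
theorem ind1_infinite_of_stripAut_infinite {v₀ : T.V} (hinf : (L.stripAut v₀).Infinite) (j : T.Label) :
    (L.Ind1 j).Infinite := by
  classical
  set i₀ : T.Caps j := 0 with hi₀
  set vQ₀ : T.VQ := T.over v₀ with hvQ₀
  set w₀ : T.Fibre vQ₀ := T.toFibre v₀ with hw₀
  -- the strip data: `ψ` at `(i₀, v₀)`, identity elsewhere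
  let hfam : (L.carrier v₀ ≃ₗ[ℚ] L.carrier v₀) → T.Caps j → ∀ v : T.V, L.carrier v ≃ₗ[ℚ] L.carrier v :=
    fun ψ i => if i = i₀ then Function.update (fun v => LinearEquiv.refl ℚ (L.carrier v)) v₀ ψ
      else fun v => LinearEquiv.refl ℚ (L.carrier v)
  let Fam : (L.carrier v₀ ≃ₗ[ℚ] L.carrier v₀) → ∀ vQ : T.VQ, L.Packet j vQ ≃ₗ[ℚ] L.Packet j vQ :=
    fun ψ vQ => (L.permute j vQ (Equiv.refl _)).trans (L.factorwise j vQ fun i => L.summandwise vQ fun v => hfam ψ i v.1)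
  -- it lands in `Ind1 j`
  have hmaps : Set.MapsTo Fam (L.stripAut v₀) (L.Ind1 j) := by
    intro ψ hψ
    refine ⟨Equiv.refl _, hfam ψ, fun i v => ?_, fun vQ => rfl⟩
    by_cases hi : i = i₀
    · show (if i = i₀ then Function.update (fun v => LinearEquiv.refl ℚ (L.carrier v)) v₀ ψ
        else fun v => LinearEquiv.refl ℚ (L.carrier v)) v ∈ L.stripAut v
      rw [if_pos hi]
      by_cases hv : v = v₀
      · rw [hv, Function.update_self]
        exact hψ
      · rw [Function.update_of_ne hv]
        exact L.one_mem_stripAut v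
    · show (if i = i₀ then Function.update (fun v => LinearEquiv.refl ℚ (L.carrier v)) v₀ ψ
        else fun v => LinearEquiv.refl ℚ (L.carrier v)) v ∈ L.stripAut v
      rw [if_neg hi]
      exact L.one_mem_stripAut v
  -- it is injective
  have hinj : Set.InjOn Fam (L.stripAut v₀) := by
    intro ψ _ ψ' _ hF
    apply LinearEquiv.ext
    intro x
    -- the test vector `m = (x at v₀, 0 elsewhere)` and the value of `Fam ψ` on `m ⊗ ⋯ ⊗ m`
    let m : ∀ v : T.Fibre vQ₀, L.carrier v.1 := Pi.single w₀ x
    have heval : ∀ χ : L.carrier v₀ ≃ₗ[ℚ] L.carrier v₀,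
        (Fam χ vQ₀) (L.tprod j vQ₀ fun _ => m) =
          L.tprod j vQ₀ (fun i => if i = i₀ then (Pi.single w₀ (χ x) : ∀ v : T.Fibre vQ₀, L.carrier v.1) else m) := by
      intro χ
      change (L.factorwise j vQ₀ fun i => L.summandwise vQ₀ fun v => hfam χ i v.1)
          ((L.permute j vQ₀ (Equiv.refl _)) (L.tprod j vQ₀ fun _ => m)) = _
      rw [L.permute_refl, LinearEquiv.refl_apply, L.factorwise_summandwise_tprod]
      congr 1
      funext i
      funext v
      change ((if i = i₀ then Function.update (fun v => LinearEquiv.refl ℚ (L.carrier v)) v₀ χ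
          else fun v => LinearEquiv.refl ℚ (L.carrier v)) v.1) (m v) = _
      by_cases hi : i = i₀
      · rw [if_pos hi, if_pos hi]
        by_cases hv : v = w₀
        · rw [hv]
          change (Function.update (fun v => LinearEquiv.refl ℚ (L.carrier v)) v₀ χ v₀)
              ((Pi.single w₀ x : ∀ v : T.Fibre vQ₀, L.carrier v.1) w₀) =
            (Pi.single w₀ (χ x) : ∀ v : T.Fibre vQ₀, L.carrier v.1) w₀
          rw [Function.update_self, Pi.single_eq_same, Pi.single_eq_same]
        · change (Function.update (fun v => LinearEquiv.refl ℚ (L.carrier v)) v₀ χ v.1)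
              ((Pi.single w₀ x : ∀ v : T.Fibre vQ₀, L.carrier v.1) v) =
            (Pi.single w₀ (χ x) : ∀ v : T.Fibre vQ₀, L.carrier v.1) v
          rw [Pi.single_eq_of_ne hv, Pi.single_eq_of_ne hv, map_zero]
      · rw [if_neg hi, if_neg hi]
        rfl
    -- a functional `λ` with `λ x = 1` (if `x ≠ 0`)
    by_cases hx : x = 0
    · rw [hx, map_zero, map_zero]
    obtain ⟨lam, hlam⟩ : ∃ lam : Module.Dual ℚ (L.carrier v₀), lam x = 1 := by
      obtain ⟨φ, hφ⟩ : ∃ φ : Module.Dual ℚ (L.carrier v₀), φ x ≠ 0 := by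
        by_contra h
        push Not at h
        exact hx ((Module.forall_dual_apply_eq_zero_iff ℚ x).mp h)
      exact ⟨(φ x)⁻¹ • φ, by rw [LinearMap.smul_apply, smul_eq_mul, inv_mul_cancel₀ hφ]⟩
    -- test with every `μ`: `μ (ψ x) = μ (ψ' x)`
    rw [← sub_eq_zero, ← (Module.forall_dual_apply_eq_zero_iff ℚ (ψ x - ψ' x))]
    intro μ
    rw [map_sub, sub_eq_zero]
    -- the functional `⊗_i (λ_i ∘ pr_{w₀})`
    let pr : L.Packet1 vQ₀ →ₗ[ℚ] L.carrier v₀ := LinearMap.proj (R := ℚ) (φ := fun v : T.Fibre vQ₀ => L.carrier v.1) w₀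
    have hpr : ∀ y : L.carrier v₀, pr (Pi.single w₀ y : ∀ v : T.Fibre vQ₀, L.carrier v.1) = y := fun y => by
      change (Pi.single w₀ y : ∀ v : T.Fibre vQ₀, L.carrier v.1) w₀ = y
      exact Pi.single_eq_same _ _
    let f : T.Caps j → Module.Dual ℚ (L.Packet1 vQ₀) := fun i => if i = i₀ then μ ∘ₗ pr else lam ∘ₗ pr
    have hf₀ : f i₀ = μ ∘ₗ pr := if_pos rfl
    have hf₁ : ∀ i, i ≠ i₀ → f i = lam ∘ₗ pr := fun i hi => if_neg hi
    let Λ : Module.Dual ℚ (⨂[ℚ] _i : T.Caps j, L.Packet1 vQ₀) := PiTensorProduct.dualDistrib (⨂ₜ[ℚ] i, f i)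
    have hΛ : ∀ χ : L.carrier v₀ ≃ₗ[ℚ] L.carrier v₀,
        Λ (L.tprod j vQ₀ (fun i => if i = i₀ then (Pi.single w₀ (χ x) : ∀ v : T.Fibre vQ₀, L.carrier v.1) else m)) =
          μ (χ x) := by
      intro χ
      change PiTensorProduct.dualDistrib (⨂ₜ[ℚ] i, f i) (PiTensorProduct.tprod ℚ _) = _
      rw [PiTensorProduct.dualDistrib_apply, Finset.prod_eq_single i₀]
      · rw [if_pos rfl, hf₀, LinearMap.comp_apply, hpr]
      · intro i _ hi
        rw [if_neg hi, hf₁ i hi, LinearMap.comp_apply, hpr]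
        exact hlam
      · intro h
        exact absurd (Finset.mem_univ i₀) h
    have h : Λ ((Fam ψ vQ₀) (L.tprod j vQ₀ fun _ => m)) = Λ ((Fam ψ' vQ₀) (L.tprod j vQ₀ fun _ => m)) := by rw [hF]
    rwa [heval ψ, heval ψ', hΛ ψ, hΛ ψ'] at h
  exact ((Set.infinite_image_iff hinj).mpr hinf).mono hmaps.image_subset

/-- **The same for the set `Ind1Family` of label-indexed (Ind1)-families** (`Thm311Multirad`): infinite as soon as one strip slot is —
extend an element of `Ind1 j₀` by the identity families at the other labels. [folklore] -/
theorem ind1Family_infinite_of_stripAut_infinite {v₀ : T.V} (hinf : (L.stripAut v₀).Infinite) (j₀ : T.Label) :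
    L.Ind1Family.Infinite := by
  classical
  have hI := L.ind1_infinite_of_stripAut_infinite hinf j₀
  -- extend by identities at the other labels
  let ext : (∀ vQ : T.VQ, L.Packet j₀ vQ ≃ₗ[ℚ] L.Packet j₀ vQ) → L.PacketAut :=
    fun Φ => Function.update (fun j vQ => LinearEquiv.refl ℚ (L.Packet j vQ)) j₀ Φ
  have hmaps : Set.MapsTo ext (L.Ind1 j₀) L.Ind1Family := by
    intro Φ hΦ j
    by_cases hj : j = j₀
    · subst hj
      simp only [ext, Function.update_self]
      exact hΦ
    · simp only [ext, Function.update_of_ne hj]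
      exact L.refl_mem_Ind1 j
  have hinj : Set.InjOn ext (L.Ind1 j₀) := by
    intro Φ _ Φ' _ h
    have := congrFun h j₀
    simpa only [ext, Function.update_self] using this
  exact ((Set.infinite_image_iff hinj).mpr hI).mono hmaps.image_subset

end LogShells

/-! ## 2. The real instantiations: Dupuy–Hilado's `Ind1` is finite, print's is infinite at every genuine datum -/

namespace Real

open NumberField IsDedekindDomain Literature.NumberTheory.NumberFields Literature.IUT.LogVolume
open Literature.AnabelianGeometry.AbsoluteAnabelian Literature.IUT.HodgeTheaters Cor312Prov

/-- **Dupuy–Hilado's (Ind1) is FINITE at every label** — `Real.logShellsDH` has the trivialised strip slot `{1}` (§4.7), so `Ind1 j` is the set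
of capsule permutations. [cite: DupuyHilado2025, §4.7] -/
theorem ind1_logShellsDH_finite {F : Type} [Field F] [NumberField F] (X : PilotData F) (logv : PadicLogs F)
    (j : (thetaIndex X).Label) : ((logShellsDH X logv).Ind1 j).Finite :=
  (logShellsDH X logv).ind1_finite_of_stripAut_eq_singleton (fun x => logShellsDH_stripAut X logv x) j

/-- **Print's (Ind1) is INFINITE at every label as soon as the strip slot at ONE finite place is** (`Real.logShellsPrint`, gen 8: strip slot
`Real.ind1Strip logv v` at `v ∈ 𝕍^non`). [claim: Mochizuki2012, status: disputed] [cite: DupuyHilado2025, §4.7] -/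
theorem ind1_logShellsPrint_infinite_of_ind1Strip_infinite {F : Type} [Field F] [NumberField F] (X : PilotData F)
    (logv : PadicLogs F) {v : HeightOneSpectrum (𝓞 F)} (hinf : (ind1Strip logv v).Infinite) (j : (thetaIndex X).Label) :
    ((logShellsPrint X logv).Ind1 j).Infinite ∧ (logShellsPrint X logv).Ind1Family.Infinite :=
  ⟨(logShellsPrint X logv).ind1_infinite_of_stripAut_infinite (v₀ := (.inr v : Place F)) hinf j,
    (logShellsPrint X logv).ind1Family_infinite_of_stripAut_infinite (v₀ := (.inr v : Place F)) hinf j⟩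

/-- **At `v ∣ p` odd with `[K_v : ℚ_p] ≥ 3`, modulo `JannsenWingbergTwists`**: print's `Ind1 j` (analytic-log binder) is infinite at every
label, and so is `Ind1Family` (gen 11 `ind1Strip_infinite_of_jannsenWingberg`). [claim: Mochizuki2012, status: disputed]
[cite: HoshiNishio2022OuterAutMLF, Thm 1.5, Cor 1.6 (i)] -/
theorem ind1_logShellsPrint_infinite_of_jannsenWingberg {F : Type} [Field F] [NumberField F] (X : PilotData F)
    (hJW : JannsenWingbergTwists) (v : HeightOneSpectrum (𝓞 F)) (p : ℕ) [Fact p.Prime] (hv : ((p : ℕ) : 𝓞 F) ∈ v.asIdeal)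
    (hp2 : p ≠ 2) (h3 : 3 ≤ localDeg F v) (j : (thetaIndex X).Label) :
    ((logShellsPrint X (analyticLogv F)).Ind1 j).Infinite ∧ (logShellsPrint X (analyticLogv F)).Ind1Family.Infinite :=
  ind1_logShellsPrint_infinite_of_ind1Strip_infinite X (analyticLogv F) (ind1Strip_infinite_of_jannsenWingberg v hJW p hv hp2 h3) j

/-- **AT A GENUINE INITIAL Θ-DATUM, the two readings of (Ind1) are different sets in the typed signature at EVERY label** — over the
`K`-level Dupuy–Hilado pilot datum `pilotDataOfK D K` of an initial Θ-datum `D` ([IUTchI] Def. 3.1; bad set non-empty), with the analytic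
logarithm: Dupuy–Hilado's `Ind1 j` is FINITE, print's `Ind1 j` and `Ind1Family` are INFINITE modulo `JannsenWingbergTwists` (part a: the strip
slot at any bad place `w` is infinite — `p_w ≠ 2`, `[K_w : ℚ_p] ≥ 5` by Def. 3.1 (b),(c)). [claim: Mochizuki2012, status: disputed]
[cite: DupuyHilado2025, §3.3, §4.7] [cite: JannsenWingberg1982, §5.1 p.96] -/
theorem ind1_logShellsPrint_infinite_of_mem_S_pilotDataOfK
    {F K Fbar : Type} [Field F] [NumberField F] [Field K] [NumberField K] [Algebra F K] [Field Fbar]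
    [Algebra F Fbar] [Algebra K Fbar] {E : WeierstrassCurve F} [E.IsElliptic] {l : ℕ} {Pb : BadPlacePredicates K}
    (D : InitialThetaData F K Fbar E l Pb) (hJW : JannsenWingbergTwists) (j : (thetaIndex (pilotDataOfK D K)).Label) :
    ((logShellsDH (pilotDataOfK D K) (analyticLogv K)).Ind1 j).Finite ∧
    ((logShellsPrint (pilotDataOfK D K) (analyticLogv K)).Ind1 j).Infinite ∧
    (logShellsPrint (pilotDataOfK D K) (analyticLogv K)).Ind1Family.Infinite := by
  obtain ⟨w, hS⟩ := (pilotDataOfK D K).S_nonempty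
  exact ⟨ind1_logShellsDH_finite _ _ j,
    ind1_logShellsPrint_infinite_of_ind1Strip_infinite (pilotDataOfK D K) (analyticLogv K)
      (ind1Strip_infinite_of_mem_S_pilotDataOfK D hJW hS).1 j⟩

end Real

end Summit.ABC.IUTFork.Thm311

end
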